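import Summits.CriticalPhenomena.CardyFormulaZ2.Theses.CardyDualCurrent
import Literature.Probability.LatticeModels.LocalParafermionicTemplate

/-!
# `TemplateCanonicalLimit` (stmt-CriticalPhenomena-11393) over `LocalParafermionicTemplate`

Route `CardyDualCurrent`, sub-problem `CriticalPhenomena/CardyFormulaZ2`. The route item inlines
the template datum `(r, m, z, s, g)` and its percolation observable `G` at binder level; the
Literature structure `Literature.Probability.LatticeModels.LocalParafermionicTemplate` (definition
item `defn-LocalParafermionicTemplate`) packages the same datum, with `T.obs = G` by `rfl`
(`LocalParafermionicTemplate.obs_eq`). Since rev. 9 of the route the item measures its medial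
balls with the reachability-aware `medialGraph.edist`, exactly as the structure does, so the item
is a literal re-bracketing of a statement about `T.obs` — recorded here as an `Iff`
(`templateCanonicalLimit_iff_template`), for provers of the transfer cruxes
`CanonicalLimitFromExactCR` / `MartingaleToSLE6` who prefer the structured API, together with the
specialisation to Smirnov's vertex observable `LocalParafermionicTemplate.smirnov s`
(`templateCanonicalLimit_of_smirnov`).
-/

namespace Summit.CriticalPhenomena.CardyFormulaZ2.Theorems

open Summit.CriticalPhenomena.CardyFormulaZ2.Theses.CardyDualCurrent
open Literature.Probability.LatticeModels Literature.Probability.RandomPlanarGeometry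
open Literature.Probability.Percolation
open Filter Topology MeasureTheory

/-- **`TemplateCanonicalLimit`, re-bracketed over `LocalParafermionicTemplate`.** The item holds
iff some local parafermionic template `T` and lattice constant `C > 0` have
`θ_δ · C · δ^{-1/3} · T.obs (E δ) ⌊w/δ⌋ i → q` (`q³ = ψ'/ψ`) locally uniformly on `D`, for every
Dobrushin domain `D`, every `ZdDiscretisationFamily E`, every chordal uniformizer `φ` (`ψ = φ⁻¹`),
every holomorphic cube root `q`, suitable unit phases `θ_δ` and both edge types `i`. Both
directions are definitional (`LocalParafermionicTemplate.obs_eq` is `rfl`).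
[cite: DuminilCopinSmirnov2012Lattice, Conj. 8.7 (template form posited by route CardyDualCurrent)] -/
theorem templateCanonicalLimit_iff_template :
    TemplateCanonicalLimit ↔
    ∃ (T : LocalParafermionicTemplate) (C : ℝ), 0 < C ∧
      ∀ (D : DobrushinDomain) (E : ℝ → DiscreteDobrushin), ZdDiscretisationFamily D E →
      ∀ (φ : ConformalEquiv UpperHalfPlane.upperHalfPlaneSet D.carrier),
        D.IsChordalUniformizing φ →
      ∀ q : ℂ → ℂ, DifferentiableOn ℂ q D.carrier →
        (∀ w ∈ D.carrier, q w ^ 3 = deriv φ.symm w / φ.symm w) →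
      ∃ θ : ℝ → ℂ, (∀ δ, ‖θ δ‖ = 1) ∧ ∀ i : Fin 2,
        TendstoLocallyUniformlyOn
          (fun (δ : ℝ) (w : ℂ) => θ δ * C * ((δ ^ (-(1 / 3 : ℝ)) : ℝ) : ℂ) *
            T.obs (E δ) (fun j => ⌊(if j = 0 then w.re else w.im) / δ⌋) i)
          q (𝓝[>] (0 : ℝ)) D.carrier := by
  constructor
  · rintro ⟨r, m, z, s, g, C, hC, hz, h⟩
    exact ⟨⟨r, m, z, s, g, hz⟩, C, hC, h⟩
  · rintro ⟨T, C, hC, h⟩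
    exact ⟨T.r, T.m, T.z, T.s, T.g, C, hC, T.dist_le, h⟩

/-- **Smirnov's vertex observable suffices.** If for some real spin `s` and some `C > 0` the
range-`0`, one-term template `LocalParafermionicTemplate.smirnov s` — whose observable is Smirnov's
parafermionic vertex observable `F(z) = E[Σ_{passages} exp(-i s W_γ(z))]` of the `p = 1/2`
exploration interface (`LocalParafermionicTemplate.obsUnder_smirnov`) — has the canonical limit
along every discretisation family and chordal uniformizer, then `TemplateCanonicalLimit` holds.
This is DCS Conjecture 8.7 / Smirnov 2010 Conjecture 2.4 at `q = 1` (spin `σ = 1/3`, or any `s`)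
in the family/chordal form of the route. [cite: DuminilCopinSmirnov2012Lattice, Conj. 8.7] -/
theorem templateCanonicalLimit_of_smirnov (s : ℝ) (C : ℝ) (hC : 0 < C)
    (h : ∀ (D : DobrushinDomain) (E : ℝ → DiscreteDobrushin), ZdDiscretisationFamily D E →
      ∀ (φ : ConformalEquiv UpperHalfPlane.upperHalfPlaneSet D.carrier),
        D.IsChordalUniformizing φ →
      ∀ q : ℂ → ℂ, DifferentiableOn ℂ q D.carrier →
        (∀ w ∈ D.carrier, q w ^ 3 = deriv φ.symm w / φ.symm w) →
      ∃ θ : ℝ → ℂ, (∀ δ, ‖θ δ‖ = 1) ∧ ∀ i : Fin 2,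
        TendstoLocallyUniformlyOn
          (fun (δ : ℝ) (w : ℂ) => θ δ * C * ((δ ^ (-(1 / 3 : ℝ)) : ℝ) : ℂ) *
            (LocalParafermionicTemplate.smirnov s).obs (E δ)
              (fun j => ⌊(if j = 0 then w.re else w.im) / δ⌋) i)
          q (𝓝[>] (0 : ℝ)) D.carrier) :
    TemplateCanonicalLimit :=
  templateCanonicalLimit_iff_template.2 ⟨LocalParafermionicTemplate.smirnov s, C, hC, h⟩

end Summit.CriticalPhenomena.CardyFormulaZ2.Theorems
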